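import Mathlib
import HarnessLib
import Summits.HubbardSuperconductivity.HubbardSuperconductivity.Theses.KLProgramme
import Summits.HubbardSuperconductivity.HubbardSuperconductivity.Theorems.KLProgrammeKLRegimeVolumeLimitExDefs
import Summits.HubbardSuperconductivity.HubbardSuperconductivity.Theorems.KLProgrammeKLRegimeSplitBundleV14

/-!
# Route `KLProgramme` — crux K3 gen 5, child TwoPointAssembly `KLRegimeTwoPointAssemblyV14 := TwoPointAssemblyP3 klPredsV14 FinalTwoLegVolLimitEx klWindowC`
# (stmt-HubbardSuperconductivity-19922) CLOSED AT BIRTH — universal in the bundle (`twoPointAssemblyP3_ex`, k3c5-p2); template plan2 g4, pattern = `…TwoPointAssemblyV12Closes` p477571.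
Filed 2026-08-27 by seat hubbard-kl-k3c5-p3 g4 (child-5 row) `--workitem stmt-HubbardSuperconductivity-19922` on route rev 18.
-/

noncomputable section

namespace Summit.HubbardSuperconductivity.HubbardSuperconductivity.Theorems.TwoPointAssembly

set_option linter.dupNamespace false -- summit = problem name (single-conjunct summit), D-0017

/-- **Gen-5 child TwoPointAssembly of K3 holds**, by the universal ∃-threshold assembly `KLRegimeSplit.twoPointAssemblyP3_ex`. -/
theorem KLRegimeTwoPointAssemblyV14_of :
    Summit.HubbardSuperconductivity.HubbardSuperconductivity.Theses.KLProgramme.KLRegimeTwoPointAssemblyV14 :=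
  KLRegimeSplit.twoPointAssemblyP3_ex _ _

end Summit.HubbardSuperconductivity.HubbardSuperconductivity.Theorems.TwoPointAssembly

end
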